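import Literature.Computability.FineGrained.SchoeningCoinAlgorithm
import HarnessLib

/-!
# Schöning's random-walk algorithm for `k`-SAT as a coin-string function, II: the success probability

Topic `Literature/Computability/FineGrained`; sequel of `SchoeningCoinAlgorithm.lean` (the coin-string
algorithm `run` and the counting tools; sub-namespace `SchoeningCoin`, independent of the sibling
`SchoeningWalk.lean`), towards the named fact
`Literature.Computability.FineGrained.schoening` (Schöning, FOCS 1999, Theorem). Main result:
`uniformProb_run_ge` — for a satisfiable `k`-CNF, `k ≥ 3`, the algorithm accepts with probability
`≥ 2/3` as soon as the coin string accommodates `R ≥ 2/σ` complete restarts, where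
`σ = kⁿ' / ((2^d n' + 1)(k n' + 1)(k-1)^(n'+k-3) 2ⁿ')` (`n'` the number of occurring variables,
`d = dOf k`) is the proved lower bound on the success probability of one restart — i.e.
`(2 - 2/k)^(-n')` up to a polynomial factor, Schöning's bound.

## The analysis (Schöning 1999; textbook form: Schöning–Torán 2013, §5.4; Hromkovič 2001, §5.3.7)

Fix a satisfying assignment `a`. A step from a non-satisfying `L` with first violated clause `C`
is classified by its number `u` (`cls`): *good* if `u` is the first slot of `C` whose literal is
true under `a` (`dslot`; the Hamming distance to `a` on the occurring variables, `dist`,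
decreases by one), *lazy* if `u ≥ k` (distance unchanged), *other* otherwise (distance grows by
at most one): `dist_stepL_add_le`, `dist_after_add_le`. The classes have sizes `1`, `2^d - k`,
`k - 1` whatever the state, so the class word of a walk (`pattern`) is distributed like an i.i.d.
word: `cnt_pattern` (by induction on the steps; no probability theory). A walk from distance `j`
succeeds as soon as its class word has a prefix with `#good ≥ j + #other`
(`walk_eq_true_of_prefix`); counting the prefixes of length `2^d c` with exactly `(2^d - k) c` lazy
and `c` other steps, `c = ⌈j/(k-2)⌉` (`goodP`, `F_eq`, `wsum_goodP`), and bounding the two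
binomial coefficients by the **mode inequality** `(i+p)^(i+p) ≤ (i+p+1) · C(i+p,i) · iⁱ · pᵖ`
(`pow_le_choose_mul`) gives weight `≥ N^S / ((Nc+1)(kc+1)(k-1)^((k-2)c))` (`pow_le_wsum_goodP_mul`);
summing against the distribution of the initial distance in generating-function form
(`lsum_pow_distX`: `Σ_w α^dist γ^(n'-dist) = 2^(#occ - n') (α+γ)^n'`) yields the per-restart bound
`pow_mul_le_cnt_restart_mul`; restarts read disjoint coin blocks (`cnt_run_false_le`), so
`R ≥ 2/σ` restarts all fail with probability `≤ (1 - σ)^R ≤ 1/3` (`one_sub_pow_le_third`,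
`uniformProb_run_ge`). Compared with the printed proofs we replace the Stirling / entropy estimates
of the binomial coefficients by the mode inequality (losing only polynomial factors, which the
statement absorbs) and make the uniform literal choice among `≤ k` slots with `d` coin bits and
lazy steps.

## References

* U. Schöning, *A probabilistic algorithm for k-SAT and constraint satisfaction problems*, Proc.
  40th FOCS (1999) 410–414, Theorem and its proof [key `SchoeningFOCS1999`; not held (paywalled,
  acquisition requested 2026-08-15); statement and proof read in the two textbooks below].
* U. Schöning, J. Torán, *The Satisfiability Problem: Algorithms and Analyses*, Lehmanns 2013,
  §5.4 "A Random Walk Algorithm", Theorem and its proof (Markov-chain domination, events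
  `E₁ ∧ E₂`, repetition number `t = O((4/3)^n)`) [key `SchoeningToran2013`; read 2026-08-15].
* J. Hromkovič, *Algorithmics for Hard Problems*, Springer 2001, §5.3.7, Theorem 5.3.7.2 and its
  proof (classes `Class(j)`, `p_j = C(n,j) 2^{-n}`, `q_{j,i}`, `(1 - p̃)^t ≤ e^{-p̃ t}`),
  Exercise 5.3.7.3 (general `k`) [key `Hromkovic2001`; held, read 2026-08-15, pp. 417–420].
-/

namespace Literature.Computability.FineGrained.SchoeningCoin

open _root_.Computability Complexity

variable {k : ℕ}

/-! ### The analysis: designated slots, classes of steps, the class word of a walk -/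

section Analysis

variable (φ : KCNF k) (a : ℕ → Bool) (d : ℕ)

/-- The designated slot of a clause: its first literal true under `a`. [cite: SchoeningFOCS1999, Theorem (proof: "fix in every clause one literal satisfied by α*")] -/
def dslot (c : List (ℕ × Bool)) : ℕ := c.findIdx fun l => a l.1 == l.2

/-- The designated slot of the current step: that of the first violated clause (`0` if none).
[folklore] -/
def dsOf (L : Asg) : ℕ :=
  match viol φ L.val with
  | none => 0
  | some c => dslot a c

/-- The class of the step with number `u` from `L`. [folklore] -/
def cls (L : Asg) (u : ℕ) : Cls := clsOf k (dsOf φ a L) u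

/-- The assignment after `m` steps of the walk (the walk stepping on regardless of success; a
satisfied assignment is not moved). [folklore] -/
def after : ℕ → Asg → List Bool → Asg
  | 0, L, _ => L
  | m + 1, L, r => after m (stepL φ L (readU d r).1) (readU d r).2

/-- The class word of `m` steps of the walk from `L` on the coins `r`. [folklore] -/
def pattern : ℕ → Asg → List Bool → List Cls
  | 0, _, _ => []
  | m + 1, L, r => cls φ a L (readU d r).1 :: pattern m (stepL φ L (readU d r).1) (readU d r).2

/-- Length of the class word. [folklore] -/
@[simp] theorem length_pattern : ∀ (m : ℕ) (L : Asg) (r : List Bool), (pattern φ a d m L r).length = m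
  | 0, _, _ => rfl
  | m + 1, L, r => by simp [pattern, length_pattern m]

/-- Prefixes of the class word are class words. [folklore] -/
theorem take_pattern : ∀ (m t : ℕ) (L : Asg) (r : List Bool), t ≤ m →
    (pattern φ a d m L r).take t = pattern φ a d t L r
  | m, 0, L, r, _ => by simp [pattern]
  | 0, t + 1, L, r, h => by omega
  | m + 1, t + 1, L, r, h => by
    simp only [pattern, List.take_succ_cons]
    rw [take_pattern m t _ _ (by omega)]

variable {φ a}

/-- The designated slot is `< k` (a clause has at most `k` literals and `a` satisfies it). [folklore] -/
theorem dsOf_lt (ha : φ.eval a = true) (hk : 1 ≤ k) (L : Asg) : dsOf φ a L < k := by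
  unfold dsOf
  split
  · omega
  · next c hc =>
    obtain ⟨hcφ, -⟩ := viol_eq_some hc
    refine lt_of_lt_of_le ?_ (φ.length_le c hcφ)
    unfold dslot
    apply List.findIdx_lt_length_of_exists
    unfold KCNF.eval at ha
    rw [List.all_eq_true] at ha
    have := ha c hcφ
    rw [List.any_eq_true] at this
    exact this

variable (φ a)

/-- **The class word is distributed like an i.i.d. word**: over the coin strings of length `d · m`,
the number of strings whose walk from `L` has a class word in `P` is the total weight of the words
in `P` — whatever `L`. (Schöning's "Markov chain" domination, in counting form: by induction on
the steps, the first block of `d` coins falling into each class a number of times that does not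
depend on the state.) [cite: SchoeningFOCS1999, Theorem (proof)] -/
theorem cnt_pattern (ha : φ.eval a = true) (hk : 1 ≤ k) (hkN : k ≤ 2 ^ d) :
    ∀ (m : ℕ) (L : Asg) (P : List Cls → Bool),
      cnt (d * m) {r | P (pattern φ a d m L r) = true} =
        wsum m (fun ρ => if P ρ = true then weight k (2 ^ d) ρ else 0)
  | 0, L, P => by
    classical
    rw [Nat.mul_zero, cnt_zero]
    simp [pattern, wsum]
  | m + 1, L, P => by
    rw [Nat.mul_succ, add_comm, cnt_add_eq_lsum]
    set G : Cls → ℕ := fun x => wsum m (fun ρ => if P (x :: ρ) = true then weight k (2 ^ d) ρ else 0)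
      with hG
    have hl : lsum d (fun w => cnt (d * m) {r | w ++ r ∈ {r | P (pattern φ a d (m + 1) L r) = true}}) =
        lsum d (fun w => G (clsOf k (dsOf φ a L) (bval w))) := by
      refine lsum_congr fun w hw => ?_
      have hr : ∀ r, readU d (w ++ r) = (bval w, r) := fun r => readU_append' w r hw
      simp only [Set.mem_setOf_eq, pattern, hr]
      exact cnt_pattern ha hk hkN m _ (fun ρ => P (cls φ a L (bval w) :: ρ))
    rw [hl, show (lsum d fun w => G (clsOf k (dsOf φ a L) (bval w))) =
        ∑ u ∈ Finset.range (2 ^ d), G (clsOf k (dsOf φ a L) u) from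
      lsum_bval d (fun u => G (clsOf k (dsOf φ a L) u)), sum_range_clsOf (dsOf_lt ha hk L) hkN]
    simp only [wsum, weight_cons]
    have h3 : ∀ x : Cls, wsum m (fun ρ => if P (x :: ρ) = true then x.size k (2 ^ d) * weight k (2 ^ d) ρ else 0) =
        G x * x.size k (2 ^ d) := by
      intro x
      rw [hG, mul_comm, ← wsum_mul]
      exact wsum_congr fun ρ _ => by split <;> simp
    rw [h3, h3, h3]

/-- **Locality of the walk**: on `S · d` coins followed by anything, the walk has the same success
bit as on the `S · d` coins alone, and if it fails it has consumed exactly them. [folklore] -/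
theorem walk_append : ∀ (S : ℕ) (L : Asg) (w r : List Bool), w.length = S * d →
    (walk φ d S L (w ++ r)).1 = (walk φ d S L w).1 ∧
      ((walk φ d S L w).1 = false → (walk φ d S L (w ++ r)).2 = r)
  | 0, L, w, r, hw => by
    simp only [Nat.zero_mul, List.length_eq_zero_iff] at hw
    subst hw
    simp [walk]
  | S + 1, L, w, r, hw => by
    have hsplit : w = w.take d ++ w.drop d := (List.take_append_drop d w).symm
    have ht : (w.take d).length = d := by rw [List.length_take]; rw [Nat.succ_mul] at hw; omega
    have hd : (w.drop d).length = S * d := by rw [List.length_drop, hw, Nat.succ_mul]; omega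
    have h1 : readU d (w ++ r) = (bval (w.take d), w.drop d ++ r) := by
      have := readU_append' (w.take d) (w.drop d ++ r) ht
      rwa [← List.append_assoc, List.take_append_drop] at this
    have h2 : readU d w = (bval (w.take d), w.drop d) := by
      have := readU_append' (w.take d) (w.drop d) ht
      rwa [List.take_append_drop] at this
    simp only [walk, h1, h2]
    split_ifs with he
    · simp
    · exact walk_append S _ _ r hd

/-- **Locality of a restart**: on `cpr`-many coins followed by anything (`cpr = #occurrences + S d`),
a restart has the same success bit as on the first `cpr` coins, and if it fails it has consumed
exactly them. [folklore] -/
theorem restart_append (S : ℕ) (w r : List Bool) (hw : w.length = (occs φ).length + S * d) :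
    (restart φ d S (w ++ r)).1 = (restart φ d S w).1 ∧
      ((restart φ d S w).1 = false → (restart φ d S (w ++ r)).2 = r) := by
  have hsplit : w = w.take (occs φ).length ++ w.drop (occs φ).length := (List.take_append_drop _ w).symm
  have ht : (w.take (occs φ).length).length = (occs φ).length := by rw [List.length_take]; omega
  have hd : (w.drop (occs φ).length).length = S * d := by rw [List.length_drop, hw]; omega
  unfold restart
  rw [hsplit, List.append_assoc, initL_append _ _ _ _ ht, initL_append _ _ _ _ ht]
  exact walk_append φ d S _ _ r hd

/-- Failure of the walk: none of the first `S` assignments passed satisfies `φ`. [folklore] -/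
theorem walk_eq_false_iff : ∀ (S : ℕ) (L : Asg) (r : List Bool),
    (walk φ d S L r).1 = false ↔ ∀ t < S, φ.eval (after φ d t L r).val = false
  | 0, L, r => by simp [walk]
  | S + 1, L, r => by
    unfold walk
    split_ifs with he
    · simp only [false_iff, not_forall]
      exact ⟨0, Nat.succ_pos S, by simp [after, he]⟩
    · rw [walk_eq_false_iff S]
      constructor
      · intro h t ht
        rcases t with _ | t
        · simpa [after] using he
        · exact h t (by omega)
      · intro h t ht
        exact h (t + 1) (by omega)

/-! ### The analysis: Hamming distance to the satisfying assignment -/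

/-- The Hamming distance of `v` to `a` on the finite set `X` of variables. [cite: SchoeningFOCS1999, Theorem (proof: the distance to α*)] -/
def distX (X : Finset ℕ) (v : ℕ → Bool) : ℕ := (X.filter fun x => v x ≠ a x).card

/-- The occurring variables. [folklore] -/
def vars : Finset ℕ := (occs φ).toFinset

/-- `n'`: the number of occurring variables. [folklore] -/
def nv : ℕ := (vars φ).card

/-- The distance of the current assignment to `a` on the occurring variables. [folklore] -/
def dist (L : Asg) : ℕ := distX a (vars φ) L.val

variable {φ a d}

/-- The distance is at most the number of variables. [folklore] -/
theorem distX_le (X : Finset ℕ) (v : ℕ → Bool) : distX a X v ≤ X.card := Finset.card_filter_le _ _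

/-- Distance zero means agreement on `X`. [folklore] -/
theorem distX_eq_zero_iff (X : Finset ℕ) (v : ℕ → Bool) : distX a X v = 0 ↔ ∀ x ∈ X, v x = a x := by
  unfold distX
  rw [Finset.card_eq_zero, Finset.filter_eq_empty_iff]
  simp

/-- Changing one variable changes the distance by at most one. [folklore] -/
theorem distX_le_succ_of_eq (X : Finset ℕ) {v w : ℕ → Bool} (x : ℕ) (h : ∀ y, y ≠ x → w y = v y) :
    distX a X w ≤ distX a X v + 1 := by
  unfold distX
  calc (X.filter fun y => w y ≠ a y).card
      ≤ (insert x (X.filter fun y => v y ≠ a y)).card := by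
        refine Finset.card_le_card fun y hy => ?_
        rw [Finset.mem_insert, Finset.mem_filter]
        rw [Finset.mem_filter] at hy
        by_cases hyx : y = x
        · exact Or.inl hyx
        · exact Or.inr ⟨hy.1, by rw [← h y hyx]; exact hy.2⟩
    _ ≤ _ := Finset.card_insert_le _ _

/-- Correcting one wrong variable of `X` decreases the distance by one. [folklore] -/
theorem distX_succ_of_ne (X : Finset ℕ) {v w : ℕ → Bool} (x : ℕ) (hx : x ∈ X) (hvx : v x ≠ a x)
    (hwx : w x = a x) (h : ∀ y, y ≠ x → w y = v y) : distX a X w + 1 = distX a X v := by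
  unfold distX
  have : (X.filter fun y => w y ≠ a y) = (X.filter fun y => v y ≠ a y).erase x := by
    ext y
    rw [Finset.mem_erase, Finset.mem_filter, Finset.mem_filter]
    by_cases hyx : y = x
    · subst hyx; simp [hwx]
    · rw [h y hyx]; simp [hyx]
  rw [this, Finset.card_erase_add_one]
  exact Finset.mem_filter.2 ⟨hx, hvx⟩

/-- **One step**: unless `L` satisfies `φ`, a good step decreases the distance by one and any step
increases it by at most one, lazy steps and steps beyond the clause not at all:
`dist(step) + [good] ≤ dist + [other]`. [cite: SchoeningFOCS1999, Theorem (proof: the coupling with the random walk on ℕ)] -/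
theorem dist_stepL_add_le (ha : φ.eval a = true) {L : Asg} (hL : φ.eval L.val = false)
    (u : ℕ) :
    dist φ a (stepL φ L u) + (if cls φ a L u = .good then 1 else 0) ≤
      dist φ a L + (if cls φ a L u = .other then 1 else 0) := by
  have hv : viol φ L.val ≠ none := fun h => by
    rw [← eval_eq_true_iff_viol_eq_none] at h; rw [h] at hL; exact Bool.noConfusion hL
  obtain ⟨c, hc⟩ := Option.ne_none_iff_exists'.1 hv
  obtain ⟨hcφ, hfalse⟩ := viol_eq_some hc
  have hds : dsOf φ a L = dslot a c := by unfold dsOf; rw [hc]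
  -- the designated literal exists and is false under `L`, true under `a`
  have hex : ∃ l ∈ c, (a l.1 == l.2) = true := by
    unfold KCNF.eval at ha
    rw [List.all_eq_true] at ha
    exact (List.any_eq_true.1 (ha c hcφ))
  have hdl : dslot a c < c.length := List.findIdx_lt_length_of_exists hex
  have step_eq : stepL φ L u = if h : u < c.length then flipVar L (c.get ⟨u, h⟩).1 else L := by
    unfold stepL; rw [hc]
  unfold cls clsOf
  rw [hds]
  by_cases hu : u = dslot a c
  · -- good step
    subst hu
    rw [if_pos rfl, step_eq, dif_pos hdl]
    have e1 : (if Cls.good = Cls.good then 1 else 0) = 1 := if_pos rfl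
    have e2 : (if Cls.good = Cls.other then 1 else 0) = 0 := if_neg (by decide)
    rw [e1, e2, Nat.add_zero]
    set l := c.get ⟨dslot a c, hdl⟩ with hl
    have hlmem : l ∈ c := List.get_mem _ _
    have hal : a l.1 = l.2 := by
      have hdl' : c.findIdx (fun l => a l.1 == l.2) < c.length := hdl
      have := List.findIdx_getElem (w := hdl')
      simpa [hl, dslot] using this
    have hLl : L.val l.1 ≠ a l.1 := by rw [hal]; exact hfalse l hlmem
    have hocc : l.1 ∈ vars φ := by
      unfold vars
      rw [List.mem_toFinset]
      exact List.mem_flatMap.2 ⟨c, hcφ, List.mem_map.2 ⟨l, hlmem, rfl⟩⟩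
    have hwx : (flipVar L l.1).val l.1 = a l.1 := by
      rw [val_flipVar, if_pos rfl]
      revert hLl
      cases L.val l.1 <;> cases a l.1 <;> simp
    have hoth : ∀ y, y ≠ l.1 → (flipVar L l.1).val y = L.val y := fun y hy => by
      rw [val_flipVar, if_neg (Ne.symm hy)]
    have key := distX_succ_of_ne (a := a) (vars φ) l.1 hocc hLl hwx hoth
    unfold dist
    omega
  · rw [if_neg hu]
    by_cases hku : k ≤ u
    · -- lazy step: nothing happens
      rw [if_pos hku, if_neg (by simp), if_neg (by simp), step_eq,
        dif_neg (by have := φ.length_le c hcφ; omega)]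
    · rw [if_neg hku, if_neg (by simp), if_pos rfl, Nat.add_zero, step_eq]
      split_ifs with h
      · unfold dist
        refine distX_le_succ_of_eq (vars φ) (c.get ⟨u, h⟩).1 fun y hy => ?_
        rw [val_flipVar, if_neg (Ne.symm hy)]
      · omega

/-- **Along the walk**: unless one of the first `m` assignments satisfies `φ`,
`dist(after m steps) + #good ≤ dist(start) + #other`. [cite: SchoeningFOCS1999, Theorem (proof)] -/
theorem dist_after_add_le (ha : φ.eval a = true) :
    ∀ (m : ℕ) (L : Asg) (r : List Bool), (∀ t < m, φ.eval (after φ d t L r).val = false) →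
      dist φ a (after φ d m L r) + (pattern φ a d m L r).count .good ≤
        dist φ a L + (pattern φ a d m L r).count .other
  | 0, L, r, _ => by simp [after, pattern]
  | m + 1, L, r, h => by
    have h0 : φ.eval L.val = false := by simpa [after] using h 0 (Nat.succ_pos m)
    have h1 := dist_stepL_add_le ha h0 (readU d r).1
    have h2 := dist_after_add_le ha m (stepL φ L (readU d r).1) (readU d r).2
      (fun t ht => h (t + 1) (by omega))
    simp only [after, pattern, List.count_cons, beq_iff_eq]
    split_ifs at h1 ⊢ <;> simp_all <;> omega

/-- **Success criterion**: if some prefix of length `t < S` of the class word has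
`#good ≥ dist(start) + #other`, the walk of `S` steps succeeds. [cite: SchoeningFOCS1999, Theorem (proof)] -/
theorem walk_eq_true_of_prefix (ha : φ.eval a = true) {S t : ℕ} (hts : t < S)
    {L : Asg} {r : List Bool}
    (h : dist φ a L + (pattern φ a d t L r).count .other ≤ (pattern φ a d t L r).count .good) :
    (walk φ d S L r).1 = true := by
  by_contra hw
  rw [Bool.not_eq_true, walk_eq_false_iff] at hw
  have h1 := dist_after_add_le (d := d) ha t L r fun t' ht' => hw t' (by omega)
  have h0 : dist φ a (after φ d t L r) = 0 := by omega
  have : φ.eval (after φ d t L r).val = true := by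
    rw [← ha]
    apply eval_congr_occs
    intro x hx
    exact (distX_eq_zero_iff (a := a) (vars φ) _).1 h0 x (List.mem_toFinset.2 hx)
  rw [hw t hts] at this
  exact Bool.noConfusion this

end Analysis


/-! ### The mode inequality for binomial terms -/

section Mode

variable (i p : ℕ)

/-- The terms of the binomial expansion of `(i + p)^(i+p)`: `C(i+p, l) iˡ p^(i+p-l)`. [folklore] -/
def tm (l : ℕ) : ℕ := (i + p).choose l * i ^ l * p ^ (i + p - l)

/-- The ratio of consecutive terms, cross-multiplied:
`tm (l+1) · (l+1) p = tm l · (i+p-l) i`. [folklore] -/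
theorem tm_succ_mul (l : ℕ) : tm i p (l + 1) * ((l + 1) * p) = tm i p l * ((i + p - l) * i) := by
  unfold tm
  by_cases hl : l < i + p
  · have h1 := Nat.choose_succ_right_eq (i + p) l
    have h2 : p ^ (i + p - l) = p ^ (i + p - (l + 1)) * p := by
      rw [← pow_succ]; congr 1; omega
    calc (i + p).choose (l + 1) * i ^ (l + 1) * p ^ (i + p - (l + 1)) * ((l + 1) * p)
        = ((i + p).choose (l + 1) * (l + 1)) * i ^ l * i * (p ^ (i + p - (l + 1)) * p) := by ring
      _ = ((i + p).choose l * (i + p - l)) * i ^ l * i * p ^ (i + p - l) := by rw [h1, h2]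
      _ = _ := by ring
  · have h0 : (i + p).choose (l + 1) = 0 := Nat.choose_eq_zero_of_lt (by omega)
    have h0' : i + p - l = 0 := by omega
    simp [h0, h0']

/-- The terms increase up to `l = i`. [folklore] -/
theorem tm_le_tm_succ {l : ℕ} (hl : l < i) : tm i p l ≤ tm i p (l + 1) := by
  rcases Nat.eq_zero_or_pos p with hp | hp
  · subst hp
    unfold tm
    rw [Nat.add_zero, zero_pow (by omega : i - l ≠ 0)]
    simp
  · have hA : 0 < (l + 1) * p := Nat.mul_pos (Nat.succ_pos l) hp
    have hAB : (l + 1) * p ≤ (i + p - l) * i := by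
      obtain ⟨e, rfl⟩ : ∃ e, i = l + 1 + e := ⟨i - (l + 1), by omega⟩
      rw [show l + 1 + e + p - l = e + p + 1 by omega]
      nlinarith
    have h : tm i p l * ((l + 1) * p) ≤ tm i p (l + 1) * ((l + 1) * p) := by
      rw [tm_succ_mul]; exact Nat.mul_le_mul_left _ hAB
    exact Nat.le_of_mul_le_mul_right h hA

/-- The terms decrease from `l = i` on. [folklore] -/
theorem tm_succ_le_tm {l : ℕ} (hl : i ≤ l) : tm i p (l + 1) ≤ tm i p l := by
  by_cases hlm : l < i + p
  · have hp : 0 < p := by omega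
    have hA : 0 < (l + 1) * p := Nat.mul_pos (Nat.succ_pos l) hp
    have hBA : (i + p - l) * i ≤ (l + 1) * p := by
      obtain ⟨e, rfl⟩ : ∃ e, l = i + e := ⟨l - i, by omega⟩
      rw [show i + p - (i + e) = p - e by omega]
      calc (p - e) * i ≤ p * i := Nat.mul_le_mul_right _ (Nat.sub_le _ _)
        _ ≤ (i + e + 1) * p := by nlinarith
    have h : tm i p (l + 1) * ((l + 1) * p) ≤ tm i p l * ((l + 1) * p) := by
      rw [tm_succ_mul]; exact Nat.mul_le_mul_left _ hBA
    exact Nat.le_of_mul_le_mul_right h hA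
  · unfold tm
    rw [Nat.choose_eq_zero_of_lt (by omega)]
    simp

/-- Every term is at most the central one `l = i` (below). [folklore] -/
theorem tm_le_of_le : ∀ (j l : ℕ), l + j = i → tm i p l ≤ tm i p i
  | 0, l, h => by rw [Nat.add_zero] at h; rw [h]
  | j + 1, l, h => (tm_le_tm_succ i p (by omega)).trans (tm_le_of_le j (l + 1) (by omega))

/-- Every term is at most the central one `l = i` (above). [folklore] -/
theorem tm_le_of_ge : ∀ (j : ℕ), tm i p (i + j) ≤ tm i p i
  | 0 => le_rfl
  | j + 1 => (tm_succ_le_tm i p (Nat.le_add_right i j)).trans (tm_le_of_ge j)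

/-- **The mode term dominates.** [folklore] -/
theorem tm_le (l : ℕ) : tm i p l ≤ tm i p i := by
  rcases le_or_gt l i with h | h
  · exact tm_le_of_le i p (i - l) l (by omega)
  · obtain ⟨j, rfl⟩ : ∃ j, l = i + j := ⟨l - i, by omega⟩
    exact tm_le_of_ge i p j

/-- The terms sum to `(i+p)^(i+p)` (binomial theorem). [folklore] -/
theorem sum_tm : ∑ l ∈ Finset.range (i + p + 1), tm i p l = (i + p) ^ (i + p) := by
  rw [add_pow]
  refine Finset.sum_congr rfl fun l _ => ?_
  unfold tm
  push_cast
  ring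

/-- **Mode inequality for binomial terms**: `(i+p)^(i+p) ≤ (i+p+1) · C(i+p, i) · iⁱ · pᵖ` — the
largest of the `i + p + 1` terms of the binomial expansion of `(i + p)^(i+p)` is the one with
`l = i`, so it is at least the average. (The elementary form of "the binomial distribution
`Bin(m, i/m)` takes its mode `i` with probability `≥ 1/(m+1)`".) [folklore] -/
theorem pow_le_choose_mul : (i + p) ^ (i + p) ≤ (i + p + 1) * ((i + p).choose i * i ^ i * p ^ p) := by
  have h : (i + p).choose i * i ^ i * p ^ p = tm i p i := by
    unfold tm; rw [Nat.add_sub_cancel_left]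
  rw [h, ← sum_tm]
  calc ∑ l ∈ Finset.range (i + p + 1), tm i p l ≤ ∑ _l ∈ Finset.range (i + p + 1), tm i p i :=
        Finset.sum_le_sum fun l _ => tm_le i p l
    _ = (i + p + 1) * tm i p i := by rw [Finset.sum_const, Finset.card_range, smul_eq_mul]

/-- Scaled form: `(α+β)^((α+β)c) ≤ ((α+β)c + 1) · C((α+β)c, αc) · α^(αc) · β^(βc)`. [folklore] -/
theorem pow_le_choose_mul_scaled (α β c : ℕ) :
    (α + β) ^ ((α + β) * c) ≤ ((α + β) * c + 1) * (((α + β) * c).choose (α * c) * α ^ (α * c) * β ^ (β * c)) := by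
  rcases Nat.eq_zero_or_pos c with hc | hc
  · subst hc; simp
  · have h := pow_le_choose_mul (α * c) (β * c)
    rw [← Nat.add_mul] at h
    have hc' : 0 < c ^ ((α + β) * c) := Nat.pow_pos hc
    refine Nat.le_of_mul_le_mul_right ?_ hc'
    calc (α + β) ^ ((α + β) * c) * c ^ ((α + β) * c) = ((α + β) * c) ^ ((α + β) * c) := by
          rw [← Nat.mul_pow]
      _ ≤ _ := h
      _ = _ := by
        rw [Nat.mul_pow, Nat.mul_pow, show c ^ ((α + β) * c) = c ^ (α * c) * c ^ (β * c) by
          rw [Nat.add_mul, pow_add]]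
        ring

end Mode

/-! ### Counting class words with prescribed numbers of lazy and other letters -/

/-- `F m ℓ c`: the number of class words of length `m` with exactly `ℓ` lazy and `c` other letters.
[folklore] -/
def F (m ℓ c : ℕ) : ℕ := wsum m (fun ρ => if ρ.count .lazy = ℓ ∧ ρ.count .other = c then 1 else 0)

/-- `wsum` of zero. [folklore] -/
theorem wsum_zero : ∀ m : ℕ, wsum m (fun _ => 0) = 0
  | 0 => rfl
  | m + 1 => by simp [wsum, wsum_zero m]

/-- `F` on the empty word. [folklore] -/
theorem F_zero (ℓ c : ℕ) : F 0 ℓ c = if ℓ = 0 ∧ c = 0 then 1 else 0 := by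
  unfold F
  simp only [wsum, List.count_nil]
  by_cases h : ℓ = 0 ∧ c = 0
  · rw [if_pos h, if_pos ⟨h.1.symm, h.2.symm⟩]
  · rw [if_neg h, if_neg (fun h' => h ⟨h'.1.symm, h'.2.symm⟩)]

/-- **Pascal-type recurrence of `F`** (first letter good, lazy or other). [folklore] -/
theorem F_succ (m ℓ c : ℕ) :
    F (m + 1) ℓ c = F m ℓ c + (if 1 ≤ ℓ then F m (ℓ - 1) c else 0) + (if 1 ≤ c then F m ℓ (c - 1) else 0) := by
  have hA : wsum m (fun ρ => if (Cls.good :: ρ).count .lazy = ℓ ∧ (Cls.good :: ρ).count .other = c then 1 else 0) =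
      F m ℓ c := wsum_congr fun ρ _ => by simp
  have hB : wsum m (fun ρ => if (Cls.lazy :: ρ).count .lazy = ℓ ∧ (Cls.lazy :: ρ).count .other = c then 1 else 0) =
      if 1 ≤ ℓ then F m (ℓ - 1) c else 0 := by
    rcases ℓ with _ | ℓ
    · rw [if_neg (by omega)]
      exact (wsum_congr fun ρ _ => by simp).trans (wsum_zero m)
    · rw [if_pos (by omega), Nat.add_sub_cancel]
      exact wsum_congr fun ρ _ => by simp
  have hC : wsum m (fun ρ => if (Cls.other :: ρ).count .lazy = ℓ ∧ (Cls.other :: ρ).count .other = c then 1 else 0) =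
      if 1 ≤ c then F m ℓ (c - 1) else 0 := by
    rcases c with _ | c
    · rw [if_neg (by omega)]
      exact (wsum_congr fun ρ _ => by simp).trans (wsum_zero m)
    · rw [if_pos (by omega), Nat.add_sub_cancel]
      exact wsum_congr fun ρ _ => by simp
  rw [← hA, ← hB, ← hC]
  rfl

/-- **`F m ℓ c = C(m, ℓ) · C(m - ℓ, c)`** (choose the lazy positions, then the other positions
among the rest), by the recurrence of `F` and Pascal's rule. [folklore] -/
theorem F_eq : ∀ (m ℓ c : ℕ), F m ℓ c = m.choose ℓ * (m - ℓ).choose c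
  | 0, ℓ, c => by
    rw [F_zero]
    rcases ℓ with _ | ℓ <;> rcases c with _ | c <;> simp
  | m + 1, ℓ, c => by
    rw [F_succ, F_eq m ℓ c]
    rcases ℓ with _ | ℓ
    · rw [if_neg (by omega), Nat.add_zero, Nat.choose_zero_right, Nat.choose_zero_right, one_mul, one_mul,
        Nat.sub_zero, Nat.sub_zero]
      rcases c with _ | c
      · simp
      · rw [if_pos (by omega), F_eq, Nat.add_sub_cancel, Nat.choose_zero_right, one_mul, Nat.sub_zero,
          Nat.choose_succ_succ', add_comm]
    · rw [if_pos (by omega), Nat.add_sub_cancel, F_eq, show m + 1 - (ℓ + 1) = m - ℓ by omega]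
      rcases c with _ | c
      · rw [if_neg (by omega), Nat.add_zero]
        simp only [Nat.choose_zero_right, mul_one]
        rw [Nat.choose_succ_succ', add_comm]
      · rw [if_pos (by omega), F_eq, Nat.add_sub_cancel]
        by_cases hlm : ℓ + 1 ≤ m
        · have e1 : m - ℓ = (m - (ℓ + 1)) + 1 := by omega
          rw [e1, Nat.choose_succ_succ' (m - (ℓ + 1)) c, Nat.choose_succ_succ' m ℓ]
          ring
        · have e1 : m.choose (ℓ + 1) = 0 := Nat.choose_eq_zero_of_lt (by omega)
          have e2 : m - ℓ = 0 := by omega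
          have e3 : m - (ℓ + 1) = 0 := by omega
          rw [e1, e2, e3, Nat.choose_zero_succ]
          simp

/-- The weight of a word is determined by its letter counts. [folklore] -/
theorem weight_eq_pow (k N : ℕ) : ∀ ρ : List Cls,
    weight k N ρ = (N - k) ^ ρ.count .lazy * (k - 1) ^ ρ.count .other
  | [] => by simp
  | x :: ρ => by
    rw [weight_cons, weight_eq_pow k N ρ]
    cases x <;> simp [Cls.size, pow_succ] <;> ring

/-- The total weight of the words of length `m` with `ℓ` lazy and `c` other letters. [folklore] -/
theorem wsum_counts (k N m ℓ c : ℕ) :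
    wsum m (fun ρ => if ρ.count .lazy = ℓ ∧ ρ.count .other = c then weight k N ρ else 0) =
      m.choose ℓ * (m - ℓ).choose c * ((N - k) ^ ℓ * (k - 1) ^ c) := by
  rw [← F_eq, F, mul_comm, ← wsum_mul]
  refine wsum_congr fun ρ _ => ?_
  split_ifs with h
  · rw [mul_one, weight_eq_pow, h.1, h.2]
  · rfl


/-! ### The good prefixes and their weight -/

/-- The number of "other" steps the analysis allows from distance `j`: `c = ⌈j/(k-2)⌉`. [folklore] -/
def cOf (k j : ℕ) : ℕ := (j + (k - 3)) / (k - 2)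

/-- `j ≤ (k-2) c ≤ j + k - 3` and `c ≤ j`. [folklore] -/
theorem cOf_spec {k : ℕ} (hk : 3 ≤ k) (j : ℕ) :
    j ≤ (k - 2) * cOf k j ∧ (k - 2) * cOf k j ≤ j + (k - 3) ∧ cOf k j ≤ j := by
  unfold cOf
  have hpos : 0 < k - 2 := by omega
  have h1 := Nat.lt_div_mul_add (a := j + (k - 3)) hpos
  have h2 := Nat.div_mul_le_self (j + (k - 3)) (k - 2)
  refine ⟨?_, ?_, ?_⟩
  · rw [mul_comm]; omega
  · rw [mul_comm]; exact h2
  · refine Nat.lt_succ_iff.1 ((Nat.div_lt_iff_lt_mul hpos).2 ?_)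
    obtain ⟨e, he⟩ : ∃ e, k = e + 3 := ⟨k - 3, by omega⟩
    subst he
    rw [show e + 3 - 3 = e by omega, show e + 3 - 2 = e + 1 by omega]
    nlinarith

/-- The good prefixes from distance `j`: among the first `N c` steps exactly `(N - k) c` lazy and
`c` other ones (`c = cOf k j`). [cite: SchoeningFOCS1999, Theorem (proof: the paths with i wrong and j + i right steps)] -/
def goodP (k N j : ℕ) (ρ : List Cls) : Bool :=
  ((ρ.take (N * cOf k j)).count .lazy == (N - k) * cOf k j) &&
    ((ρ.take (N * cOf k j)).count .other == cOf k j)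

/-- The three letter counts of a class word add up to its length. [folklore] -/
theorem count_add_count_add_count : ∀ ρ : List Cls,
    ρ.count .good + ρ.count .lazy + ρ.count .other = ρ.length
  | [] => rfl
  | x :: ρ => by
    have := count_add_count_add_count ρ
    cases x <;> simp <;> omega

/-- **A good prefix forces success**: if the class word of the walk from `L` (at distance `j`) has a
good prefix of length `N c < S`, the walk succeeds. [cite: SchoeningFOCS1999, Theorem (proof)] -/
theorem walk_eq_true_of_goodP {φ : KCNF k} {a : ℕ → Bool} {d : ℕ} (ha : φ.eval a = true) (hk : 3 ≤ k)
    (hkN : k ≤ 2 ^ d) {S : ℕ} {L : Asg} {r : List Bool} (hmS : 2 ^ d * cOf k (dist φ a L) < S)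
    (hg : goodP k (2 ^ d) (dist φ a L) (pattern φ a d S L r) = true) : (walk φ d S L r).1 = true := by
  set N := 2 ^ d with hN
  set j := dist φ a L with hj
  set c := cOf k j with hc
  obtain ⟨hc1, -, -⟩ := cOf_spec hk j
  unfold goodP at hg
  rw [Bool.and_eq_true, beq_iff_eq, beq_iff_eq, take_pattern _ _ _ _ _ _ _ hmS.le] at hg
  refine walk_eq_true_of_prefix ha hmS ?_
  have hsum := count_add_count_add_count (pattern φ a d (N * c) L r)
  rw [length_pattern, hg.1, hg.2] at hsum
  have hNk : (N - k) * c + k * c = N * c := by rw [← Nat.add_mul, Nat.sub_add_cancel hkN]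
  have hk2 : (k - 2) * c + c + c = k * c := by
    rw [show k * c = (k - 2 + 1 + 1) * c by congr 1; omega]; ring
  rw [hg.2]
  nlinarith

/-- **The weight of the good prefixes**:
`C(Nc, (N-k)c) · C(kc, c) · (N-k)^((N-k)c) · (k-1)^c · N^(S - Nc)`. [folklore] -/
theorem wsum_goodP {k N S j : ℕ} (hk1 : 1 ≤ k) (hkN : k ≤ N) (hm : N * cOf k j ≤ S) :
    wsum S (fun ρ => if goodP k N j ρ = true then weight k N ρ else 0) =
      (N * cOf k j).choose ((N - k) * cOf k j) * (k * cOf k j).choose (cOf k j) *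
        ((N - k) ^ ((N - k) * cOf k j) * (k - 1) ^ cOf k j) * N ^ (S - N * cOf k j) := by
  set c := cOf k j with hc
  set m := N * c with hm'
  obtain ⟨t, rfl⟩ : ∃ t, S = m + t := ⟨S - m, by omega⟩
  rw [Nat.add_sub_cancel_left, wsum_add]
  have hkc : m - (N - k) * c = k * c := by
    rw [hm', show N * c = (N - k) * c + k * c by rw [← Nat.add_mul, Nat.sub_add_cancel hkN]]
    exact Nat.add_sub_cancel_left _ _
  rw [← hkc, ← wsum_counts k N m ((N - k) * c) c, ← wsum_weight hk1 hkN t, mul_comm, ← wsum_mul]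
  refine wsum_congr fun ρ₁ hρ₁ => ?_
  have htake : ∀ ρ₂ : List Cls, (ρ₁ ++ ρ₂).take m = ρ₁ := fun ρ₂ => by
    rw [List.take_append_of_le_length (by omega), List.take_of_length_le (by omega)]
  unfold goodP
  simp only [← hc, ← hm', htake, weight_append, Bool.and_eq_true, beq_iff_eq]
  by_cases h : ρ₁.count .lazy = (N - k) * c ∧ ρ₁.count .other = c
  · rw [if_pos h, show wsum t (weight k N) * weight k N ρ₁ = weight k N ρ₁ * wsum t (weight k N) from
      mul_comm _ _, ← wsum_mul]
    exact wsum_congr fun ρ₂ _ => by rw [if_pos h]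
  · rw [if_neg h, mul_zero]
    exact (wsum_congr fun ρ₂ _ => by rw [if_neg h]).trans (wsum_zero t)

/-- **Lower bound for the weight of the good prefixes**, by the mode inequality twice (once for
the lazy positions, once for the other positions among the non-lazy ones):
`N^S ≤ W · (Nc + 1)(kc + 1)(k-1)^((k-2)c)`. [cite: SchoeningFOCS1999, Theorem (proof: the estimate of the success probability from distance j)] -/
theorem pow_le_wsum_goodP_mul {k N S j : ℕ} (hk : 3 ≤ k) (hkN : k ≤ N) (hm : N * cOf k j ≤ S) :
    N ^ S ≤ wsum S (fun ρ => if goodP k N j ρ = true then weight k N ρ else 0) *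
      ((N * cOf k j + 1) * (k * cOf k j + 1) * (k - 1) ^ ((k - 2) * cOf k j)) := by
  rw [wsum_goodP (by omega) hkN hm]
  set c := cOf k j with hc
  -- the two mode inequalities
  have ha := pow_le_choose_mul_scaled (N - k) k c
  rw [Nat.sub_add_cancel hkN] at ha
  have hb := pow_le_choose_mul_scaled 1 (k - 1) c
  rw [show 1 + (k - 1) = k by omega, one_pow, mul_one, one_mul] at hb
  obtain ⟨t, rfl⟩ : ∃ t, S = N * c + t := ⟨S - N * c, by omega⟩
  rw [Nat.add_sub_cancel_left, pow_add]
  have hkk : (k - 1) ^ ((k - 1) * c) = (k - 1) ^ c * (k - 1) ^ ((k - 2) * c) := by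
    rw [← pow_add]; congr 1; rw [show k - 1 = (k - 2) + 1 by omega]; ring
  rw [hkk] at hb
  set X := (N * c).choose ((N - k) * c) with hX
  set Y := (k * c).choose c with hY
  set P := (N - k) ^ ((N - k) * c) with hP
  set Q := (k - 1) ^ c with hQ
  set Z := (k - 1) ^ ((k - 2) * c) with hZ
  calc N ^ (N * c) * N ^ t ≤ ((N * c + 1) * (X * P * k ^ (k * c))) * N ^ t := Nat.mul_le_mul_right _ ha
    _ ≤ ((N * c + 1) * (X * P * ((k * c + 1) * (Y * (Q * Z))))) * N ^ t := by gcongr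
    _ = _ := by ring

/-- The same bound with denominators uniform in `j ≤ n` (and `(k-2)c ≤ j + k - 3`). [folklore] -/
theorem pow_le_wsum_goodP_mul' {k N S n j : ℕ} (hk : 3 ≤ k) (hkN : k ≤ N) (hj : j ≤ n) (hS : N * n < S) :
    N ^ S ≤ wsum S (fun ρ => if goodP k N j ρ = true then weight k N ρ else 0) *
      ((N * n + 1) * (k * n + 1) * (k - 1) ^ (j + (k - 3))) := by
  obtain ⟨-, hc2, hc3⟩ := cOf_spec hk j
  have hcn : cOf k j ≤ n := hc3.trans hj
  refine (pow_le_wsum_goodP_mul hk hkN ((Nat.mul_le_mul_left N hcn).trans hS.le)).trans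
    (Nat.mul_le_mul_left _ ?_)
  gcongr
  omega

/-! ### The distribution of the initial distance -/

/-- The literal list laid by `initL` on a full block: the zipped block, reversed. [folklore] -/
def Lxs (xs : List ℕ) (w : List Bool) : Asg := (xs.zip w).reverse

/-- `initL` on a full block (from the empty list) lays `Lxs`. [folklore] -/
theorem initL_eq_Lxs (xs : List ℕ) (w r : List Bool) (hw : w.length = xs.length) :
    initL xs [] (w ++ r) = (Lxs xs w, r) := by
  rw [initL_append xs [] w r hw, List.append_nil]; rfl

/-- The laid list has a pair on `y` iff `y` occurs. [folklore] -/
theorem any_Lxs {xs : List ℕ} {w : List Bool} (hw : w.length = xs.length) (y : ℕ) :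
    ((Lxs xs w).any fun l => l.1 == y) = decide (y ∈ xs) := by
  unfold Lxs
  rw [List.any_reverse]
  have : ((xs.zip w).any fun l => l.1 == y) = (((xs.zip w).map Prod.fst).any fun x => x == y) := by
    rw [List.any_map]; rfl
  rw [this, List.map_fst_zip (by omega)]
  by_cases h : y ∈ xs
  · rw [decide_eq_true h, List.any_eq_true]; exact ⟨y, h, beq_self_eq_true y⟩
  · rw [decide_eq_false h, List.any_eq_false]
    intro x hx
    have hne : x ≠ y := fun e => h (e ▸ hx)
    simpa using hne

/-- Values of the laid list of a cons: later occurrences win, the head pair decides `x` only if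
`x` does not occur again. [folklore] -/
theorem val_Lxs_cons (x : ℕ) (xs : List ℕ) (b : Bool) (w : List Bool) (hw : w.length = xs.length)
    (y : ℕ) : (Lxs (x :: xs) (b :: w)).val y =
      if y ∈ xs then (Lxs xs w).val y else if x = y then b else false := by
  have : Lxs (x :: xs) (b :: w) = Lxs xs w ++ [(x, b)] := by simp [Lxs]
  rw [this, Asg.val_append, any_Lxs hw]
  by_cases h : y ∈ xs
  · simp [h]
  · simp [h]

/-- Adding a fresh variable to the index set adds its own indicator to the distance. [folklore] -/
theorem distX_insert (a : ℕ → Bool) {x : ℕ} {X : Finset ℕ} (hx : x ∉ X) (v : ℕ → Bool) :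
    distX a (insert x X) v = distX a X v + (if v x ≠ a x then 1 else 0) := by
  unfold distX
  rw [Finset.filter_insert]
  split_ifs with h
  · rw [Finset.card_insert_of_notMem (fun h' => hx (Finset.mem_filter.1 h').1)]
  · rfl

/-- The distance only depends on the values on the index set. [folklore] -/
theorem distX_congr (a : ℕ → Bool) (X : Finset ℕ) {v w : ℕ → Bool} (h : ∀ y ∈ X, v y = w y) :
    distX a X v = distX a X w := by
  unfold distX
  rw [Finset.filter_congr fun y hy => by rw [h y hy]]

/-- **The initial distance is binomially distributed** (generating-function form): over the coin
blocks `w` of one restart's initialisation,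
`Σ_w α^dist(w) γ^(n' - dist(w)) = 2^(#occurrences - n') (α + γ)^n'`, `n'` the number of distinct
variables — the value of a variable being the coin of its last occurrence, a uniformly
distributed assignment. [cite: SchoeningFOCS1999, Theorem (proof: "Pr[distance j] = C(n,j) 2^{-n}")] -/
theorem lsum_pow_distX (a : ℕ → Bool) (α γ : ℕ) : ∀ xs : List ℕ,
    lsum xs.length (fun w => α ^ distX a xs.toFinset (Lxs xs w).val *
        γ ^ (xs.toFinset.card - distX a xs.toFinset (Lxs xs w).val)) =
      2 ^ (xs.length - xs.toFinset.card) * (α + γ) ^ xs.toFinset.card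
  | [] => by simp [lsum, distX, Lxs]
  | x :: xs => by
    have ih := lsum_pow_distX a α γ xs
    have hcard : xs.toFinset.card ≤ xs.length := List.toFinset_card_le xs
    set X := xs.toFinset with hX
    set G : List Bool → ℕ := fun w => α ^ distX a X (Lxs xs w).val * γ ^ (X.card - distX a X (Lxs xs w).val)
      with hG
    rw [List.length_cons, lsum]
    by_cases hx : x ∈ xs
    · -- the head coin is irrelevant
      have hins : (x :: xs).toFinset = X := by rw [List.toFinset_cons, Finset.insert_eq_of_mem (List.mem_toFinset.2 hx)]
      have hval : ∀ (b : Bool) (w : List Bool), w.length = xs.length →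
          distX a X (Lxs (x :: xs) (b :: w)).val = distX a X (Lxs xs w).val := fun b w hw =>
        distX_congr a X fun y hy => by rw [val_Lxs_cons x xs b w hw, if_pos (List.mem_toFinset.1 hy)]
      rw [hins]
      have e0 : lsum xs.length (fun w => α ^ distX a X (Lxs (x :: xs) (false :: w)).val *
          γ ^ (X.card - distX a X (Lxs (x :: xs) (false :: w)).val)) = lsum xs.length G :=
        lsum_congr fun w hw => by simp only [hG, hval false w hw]
      have e1 : lsum xs.length (fun w => α ^ distX a X (Lxs (x :: xs) (true :: w)).val *
          γ ^ (X.card - distX a X (Lxs (x :: xs) (true :: w)).val)) = lsum xs.length G :=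
        lsum_congr fun w hw => by simp only [hG, hval true w hw]
      rw [e0, e1, ih, show xs.length + 1 - X.card = (xs.length - X.card) + 1 by omega, pow_succ]
      ring
    · -- a fresh variable: its coin decides one more coordinate
      have hxX : x ∉ X := fun h => hx (List.mem_toFinset.1 h)
      have hins : (x :: xs).toFinset = insert x X := List.toFinset_cons
      have hcard' : (insert x X).card = X.card + 1 := Finset.card_insert_of_notMem hxX
      have hval : ∀ (b : Bool) (w : List Bool), w.length = xs.length →
          distX a (insert x X) (Lxs (x :: xs) (b :: w)).val =
            distX a X (Lxs xs w).val + (if b ≠ a x then 1 else 0) := fun b w hw => by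
        rw [distX_insert a hxX, val_Lxs_cons x xs b w hw x, if_neg hx, if_pos rfl,
          distX_congr a X fun y hy => by rw [val_Lxs_cons x xs b w hw, if_pos (List.mem_toFinset.1 hy)]]
      rw [hins, hcard']
      have hdle : ∀ w : List Bool, distX a X (Lxs xs w).val ≤ X.card := fun w => distX_le X _
      have key : ∀ w : List Bool, w.length = xs.length →
          α ^ distX a (insert x X) (Lxs (x :: xs) (false :: w)).val *
              γ ^ (X.card + 1 - distX a (insert x X) (Lxs (x :: xs) (false :: w)).val) +
            α ^ distX a (insert x X) (Lxs (x :: xs) (true :: w)).val *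
              γ ^ (X.card + 1 - distX a (insert x X) (Lxs (x :: xs) (true :: w)).val) =
          (α + γ) * G w := by
        intro w hw
        rw [hval false w hw, hval true w hw, hG]
        have hd := hdle w
        set δ := distX a X (Lxs xs w).val
        cases a x
        · simp only [ne_eq, not_true, ite_false, Nat.add_zero, Bool.true_eq_false,
            not_false_eq_true, ite_true]
          rw [show X.card + 1 - δ = (X.card - δ) + 1 by omega, show X.card + 1 - (δ + 1) = X.card - δ by omega,
            pow_succ, pow_succ]
          ring
        · simp only [ne_eq, Bool.false_eq_true, not_false_eq_true, ite_true, not_true, ite_false,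
            Nat.add_zero]
          rw [show X.card + 1 - δ = (X.card - δ) + 1 by omega, show X.card + 1 - (δ + 1) = X.card - δ by omega,
            pow_succ, pow_succ]
          ring
      rw [← lsum_add, lsum_congr key, lsum_mul, ih, show xs.length + 1 - (X.card + 1) = xs.length - X.card by omega,
        pow_succ]
      ring


/-! ### The success probability of one restart -/

/-- `cnt` is monotone in the event (on strings of the right length). [folklore] -/
theorem cnt_mono_set {m : ℕ} {E E' : Set (List Bool)} (h : ∀ y : List Bool, y.length = m → y ∈ E → y ∈ E') :
    cnt m E ≤ cnt m E' := by
  classical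
  unfold cnt
  refine Finset.card_le_card fun r hr => ?_
  simp only [Finset.mem_filter, Finset.mem_univ, true_and] at hr ⊢
  exact h _ r.toList_length hr

section Restart

variable {φ : KCNF k} {a : ℕ → Bool} {d : ℕ}

/-- **Success of one walk from `L`**: over the `d · S` coins of the walk,
`2^(dS) ≤ #{success} · (N n' + 1)(k n' + 1)(k-1)^(dist L + k - 3)`. [cite: SchoeningFOCS1999, Theorem (proof: Pr[success | distance j] ≥ (1/(k-1))^j / poly)] -/
theorem pow_le_cnt_walk_mul (ha : φ.eval a = true) (hk : 3 ≤ k) (hkN : k ≤ 2 ^ d) {S : ℕ}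
    (hS : 2 ^ d * nv φ < S) (L : Asg) :
    2 ^ (d * S) ≤ cnt (d * S) {r | (walk φ d S L r).1 = true} *
      ((2 ^ d * nv φ + 1) * (k * nv φ + 1) * (k - 1) ^ (dist φ a L + (k - 3))) := by
  have hj : dist φ a L ≤ nv φ := distX_le _ _
  have h1 := pow_le_wsum_goodP_mul' (S := S) hk hkN hj hS
  rw [← cnt_pattern φ a d ha (by omega) hkN S L (goodP k (2 ^ d) (dist φ a L)), ← pow_mul] at h1
  refine h1.trans (Nat.mul_le_mul_right _ (cnt_mono_set fun r _ hr => ?_))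
  exact walk_eq_true_of_goodP ha hk hkN
    (lt_of_le_of_lt (Nat.mul_le_mul_left _ ((cOf_spec hk _).2.2.trans hj)) hS) hr

/-- **Success of one restart** (`σ ≥ (k/(2(k-1)))^n' / poly`): over the coin blocks of one
restart, `2^cpr · k^n' ≤ #{success} · (N n' + 1)(k n' + 1)(k-1)^(n' + k - 3) · 2^n'`, i.e. the
success probability is at least `(2 - 2/k)^(-n') / ((k-1)^(k-3) (N n' + 1)(k n' + 1))`.
[cite: SchoeningFOCS1999, Theorem (proof: Pr[success of one restart] ≥ (½(1 + 1/(k-1)))^n / poly)] -/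
theorem pow_mul_le_cnt_restart_mul (ha : φ.eval a = true) (hk : 3 ≤ k) (hkN : k ≤ 2 ^ d) {S : ℕ}
    (hS : 2 ^ d * nv φ < S) :
    2 ^ ((occs φ).length + S * d) * k ^ nv φ ≤
      cnt ((occs φ).length + S * d) {w | (restart φ d S w).1 = true} *
        ((2 ^ d * nv φ + 1) * (k * nv φ + 1) * (k - 1) ^ (nv φ + (k - 3)) * 2 ^ nv φ) := by
  have hn : nv φ ≤ (occs φ).length := List.toFinset_card_le _
  set D := (2 ^ d * nv φ + 1) * (k * nv φ + 1) with hD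
  rw [cnt_add_eq_lsum]
  -- per initial block
  have key : ∀ w : List Bool, w.length = (occs φ).length →
      2 ^ (d * S) * (k - 1) ^ (nv φ - dist φ a (Lxs (occs φ) w)) ≤
        cnt (S * d) {r | w ++ r ∈ {w | (restart φ d S w).1 = true}} * (D * (k - 1) ^ (nv φ + (k - 3))) := by
    intro w hw
    have hset : {r | w ++ r ∈ {w | (restart φ d S w).1 = true}} =
        {r | (walk φ d S (Lxs (occs φ) w) r).1 = true} := by
      ext r; simp only [Set.mem_setOf_eq, restart, initL_eq_Lxs _ _ _ hw]
    rw [hset, mul_comm S d]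
    have h := pow_le_cnt_walk_mul ha hk hkN hS (Lxs (occs φ) w)
    have hj : dist φ a (Lxs (occs φ) w) ≤ nv φ := distX_le _ _
    calc 2 ^ (d * S) * (k - 1) ^ (nv φ - dist φ a (Lxs (occs φ) w))
        ≤ cnt (d * S) {r | (walk φ d S (Lxs (occs φ) w) r).1 = true} *
            (D * (k - 1) ^ (dist φ a (Lxs (occs φ) w) + (k - 3))) *
            (k - 1) ^ (nv φ - dist φ a (Lxs (occs φ) w)) := Nat.mul_le_mul_right _ h
      _ = _ := by
        rw [mul_assoc, mul_assoc, ← pow_add]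
        congr 3
        omega
  -- summing over the initial blocks
  have hsum : lsum (occs φ).length (fun w => (k - 1) ^ (nv φ - dist φ a (Lxs (occs φ) w))) =
      2 ^ ((occs φ).length - nv φ) * k ^ nv φ := by
    have := lsum_pow_distX a 1 (k - 1) (occs φ)
    simp only [one_pow, one_mul, show 1 + (k - 1) = k by omega] at this
    exact this
  calc 2 ^ ((occs φ).length + S * d) * k ^ nv φ
      = (lsum (occs φ).length fun w => 2 ^ (d * S) * (k - 1) ^ (nv φ - dist φ a (Lxs (occs φ) w))) *
          2 ^ nv φ := by
        rw [lsum_mul, hsum, show (occs φ).length + S * d = d * S + ((occs φ).length - nv φ) + nv φ by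
          rw [mul_comm]; omega, pow_add, pow_add]
        ring
    _ ≤ (lsum (occs φ).length fun w => cnt (S * d) {r | w ++ r ∈ {w | (restart φ d S w).1 = true}} *
          (D * (k - 1) ^ (nv φ + (k - 3)))) * 2 ^ nv φ := Nat.mul_le_mul_right _ (lsum_mono key)
    _ = _ := by rw [lsum_mul']; ring

end Restart

/-! ### The failure probability of the whole algorithm -/

section Run

variable {φ : KCNF k} {d S : ℕ}

/-- One failing round: the ticket coin, a failing restart on the next `cpr` coins, and a failing
continuation. [folklore] -/
theorem restart_false_of_run_cons {b : Bool} {w r : List Bool} (hw : w.length = (occs φ).length + S * d)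
    (h : run φ d S (b :: (w ++ r)) = false) : (restart φ d S w).1 = false ∧ run φ d S r = false := by
  rw [run_cons, Bool.or_eq_false_iff] at h
  obtain ⟨h1, h2⟩ := restart_append φ d S w r hw
  rw [h1] at h
  refine ⟨h.1, ?_⟩
  rw [h2 h.1] at h
  exact h.2

/-- **All restarts of a failing run fail**: if `run r = false`, then for every block index `i` that
fits, the restart on the coins `r[iB + 1, iB + 1 + cpr)` fails (`B = cpr + 1`), and so does the run
on the rest. [folklore] -/
theorem restarts_false_of_run {r : List Bool} (hr0 : run φ d S r = false) :
    ∀ i : ℕ, (i + 1) * ((occs φ).length + S * d + 1) ≤ r.length →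
      (∀ i' ≤ i, (restart φ d S ((r.drop (i' * ((occs φ).length + S * d + 1) + 1)).take
        ((occs φ).length + S * d))).1 = false) ∧
      run φ d S (r.drop ((i + 1) * ((occs φ).length + S * d + 1))) = false := by
  set c := (occs φ).length + S * d with hc
  -- one block
  have step : ∀ i : ℕ, run φ d S (r.drop (i * (c + 1))) = false → (i + 1) * (c + 1) ≤ r.length →
      (restart φ d S ((r.drop (i * (c + 1) + 1)).take c)).1 = false ∧
        run φ d S (r.drop ((i + 1) * (c + 1))) = false := by
    intro i hi hlen
    set l := r.drop (i * (c + 1)) with hl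
    have hl1 : l.length = r.length - i * (c + 1) := List.length_drop
    have hlen' : c + 1 ≤ l.length := by rw [hl1, Nat.succ_mul] at *; omega
    obtain ⟨b, l', hbl⟩ : ∃ b l', l = b :: l' := by
      cases hcase : l with
      | nil => rw [hcase] at hlen'; simp at hlen'
      | cons b l' => exact ⟨b, l', rfl⟩
    have htail : l' = r.drop (i * (c + 1) + 1) := by
      rw [← List.drop_drop, ← hl, hbl]; rfl
    have hw : (l'.take c).length = c := by
      rw [List.length_take]; rw [hbl] at hlen'; simp at hlen'; omega
    have hdec : l = b :: (l'.take c ++ l'.drop c) := by rw [List.take_append_drop]; exact hbl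
    rw [hdec] at hi
    obtain ⟨h1, h2⟩ := restart_false_of_run_cons hw hi
    refine ⟨by rw [← htail]; exact h1, ?_⟩
    have : l'.drop c = r.drop ((i + 1) * (c + 1)) := by
      rw [htail, List.drop_drop]; congr 1; ring
    rwa [this] at h2
  intro i
  induction i with
  | zero =>
    intro hlen
    obtain ⟨h1, h2⟩ := step 0 (by simpa using hr0) hlen
    exact ⟨fun i' hi' => by rw [Nat.le_zero.1 hi']; exact h1, h2⟩
  | succ i ih =>
    intro hlen
    obtain ⟨hall, hrun⟩ := ih (le_trans (Nat.mul_le_mul_right _ (Nat.le_succ _)) hlen)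
    obtain ⟨h1, h2⟩ := step (i + 1) hrun hlen
    refine ⟨fun i' hi' => ?_, h2⟩
    rcases Nat.lt_or_ge i' (i + 1) with h | h
    · exact hall i' (by omega)
    · rw [show i' = i + 1 by omega]; exact h1

/-- **The failure count of the whole algorithm**: with `R` complete rounds fitting into the `m`
coins (`R (cpr + 1) ≤ m`), `#{run = false} ≤ (2 · #{restart fails})^R · 2^(m - R(cpr+1))` —
restarts read disjoint coin blocks. [cite: SchoeningFOCS1999, Theorem (proof: independent repetitions)] -/
theorem cnt_run_false_le {R m : ℕ} (hm : R * ((occs φ).length + S * d + 1) ≤ m) :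
    cnt m {r | run φ d S r = false} ≤
      (2 * cnt ((occs φ).length + S * d) {w | (restart φ d S w).1 = false}) ^ R *
        2 ^ (m - R * ((occs φ).length + S * d + 1)) := by
  set c := (occs φ).length + S * d with hc
  set B := c + 1 with hB
  set OK : Set (List Bool) := {y | (restart φ d S ((y.drop 1).take c)).1 = false} with hOK
  set E : Set (List Bool) := {y | ∀ i < R, (y.drop (i * B)).take B ∈ OK} with hE
  -- (i) a failing run has all its blocks in `OK`
  have h1 : cnt m {r | run φ d S r = false} ≤ cnt m E := by
    refine cnt_mono_set fun r hr hrun => ?_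
    simp only [hE, hOK, Set.mem_setOf_eq] at hrun ⊢
    intro i hi
    have hR : (R - 1 + 1) * B ≤ r.length := by rw [hr, Nat.sub_add_cancel (by omega)]; exact hm
    have := (restarts_false_of_run hrun (R - 1) hR).1 i (by omega)
    rw [List.drop_take, List.drop_drop, List.take_take, show min c (B - 1) = c by omega]
    exact this
  -- (ii) `E` only looks at the first `R B` coins
  have h2 : cnt m E = cnt (R * B) E * 2 ^ (m - R * B) := by
    obtain ⟨t, rfl⟩ : ∃ t, m = R * B + t := ⟨m - R * B, by omega⟩
    rw [Nat.add_sub_cancel_left, ← cnt_take]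
    refine cnt_congr fun y _ => ?_
    simp only [hE, Set.mem_setOf_eq]
    refine forall₂_congr fun i hi => ?_
    rw [List.drop_take, List.take_take, show min B (R * B - i * B) = B by
      rw [← Nat.sub_mul]; exact Nat.min_eq_left (Nat.le_mul_of_pos_left B (by omega))]
  -- (iii) the blocks are independent, (iv) the ticket coin is free
  have h3 : cnt (R * B) E = cnt B OK ^ R := cnt_blocks B OK R
  have h4 : cnt B OK = 2 * cnt c {w | (restart φ d S w).1 = false} := by
    rw [hB, cnt_succ, two_mul]
    congr 1 <;> exact cnt_congr fun y hy => by
      simp only [hOK, Set.mem_setOf_eq, List.drop_succ_cons, List.drop_zero, List.take_of_length_le hy.le]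
  calc cnt m {r | run φ d S r = false} ≤ cnt m E := h1
    _ = _ := by rw [h2, h3, h4]

end Run

/-! ### Main theorem: success probability at least `2/3` -/

/-- Bernoulli-type bound: `(1 - x)^R ≤ 1/3` once `R x ≥ 2` (`0 ≤ x ≤ 1`). [folklore] -/
theorem one_sub_pow_le_third {x : ℝ} (hx0 : 0 ≤ x) (hx1 : x ≤ 1) {R : ℕ} (hR : 2 ≤ R * x) :
    (1 - x) ^ R ≤ 1 / 3 := by
  have hB : 1 + (R : ℝ) * x ≤ (1 + x) ^ R := one_add_mul_le_pow (by linarith) R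
  have h3 : (3 : ℝ) ≤ 1 + R * x := by linarith
  have hprod : (1 - x) ^ R * (1 + x) ^ R ≤ 1 := by
    rw [← mul_pow]
    refine pow_le_one₀ (by nlinarith) (by nlinarith)
  have hpos : 0 ≤ (1 - x) ^ R := pow_nonneg (by linarith) R
  rw [le_div_iff₀ (by norm_num)]
  nlinarith

/-- **Schöning's theorem, probability half.** For a satisfiable `k`-CNF (`k ≥ 3`), with `d = dOf k`
coins per step and `S = sOf φ` steps per walk, if the coin string of length `m` accommodates `R`
complete rounds (`R (cpr φ + 1) ≤ m`) and
`R · kⁿ' ≥ 2 · (2^d n' + 1)(k n' + 1)(k-1)^(n'+k-3) 2ⁿ'` (`n'` the number of occurring variables,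
i.e. `R ≥ 2/σ` for the proved lower bound `σ` on the success probability of one restart, of order
`(2 - 2/k)^(-n') / poly`), then `run` accepts with probability at least `2/3`.
[cite: SchoeningFOCS1999, Theorem (proof: t = O((2 - 2/k)^n) independent restarts succeed with constant probability)] -/
theorem uniformProb_run_ge {φ : KCNF k} (hφ : φ.Satisfiable) (hk : 3 ≤ k) {R m : ℕ}
    (hm : R * (cpr φ + 1) ≤ m)
    (hR : 2 * ((2 ^ dOf k * nv φ + 1) * (k * nv φ + 1) * (k - 1) ^ (nv φ + (k - 3)) * 2 ^ nv φ) ≤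
      R * k ^ nv φ) :
    (2 : ℝ) / 3 ≤ uniformProb m {r | run φ (dOf k) (sOf φ) r = true} := by
  obtain ⟨a, ha⟩ := exists_eval_of_satisfiable hφ
  set d := dOf k with hd
  set S := sOf φ with hS'
  set n := nv φ with hn
  set c := cpr φ with hc
  have hkN : k ≤ 2 ^ d := (lt_two_pow_dOf k).le
  have hN2 : 2 ^ d ≤ 2 * k := two_pow_dOf_le (by omega)
  have hnocc : n ≤ (occs φ).length := List.toFinset_card_le _
  have hS : 2 ^ d * n < S := by
    rw [hS', sOf]
    calc 2 ^ d * n ≤ 2 * k * (occs φ).length := Nat.mul_le_mul hN2 hnocc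
      _ < _ := Nat.lt_succ_self _
  have hc' : c = (occs φ).length + S * d := rfl
  set Dfull := (2 ^ d * n + 1) * (k * n + 1) * (k - 1) ^ (n + (k - 3)) * 2 ^ n with hDfull
  set s := cnt c {w | (restart φ d S w).1 = true} with hs
  set f := cnt c {w | (restart φ d S w).1 = false} with hf
  -- the two counting bounds
  have hrest : 2 ^ c * k ^ n ≤ s * Dfull := by
    rw [hc', hs, hDfull]; exact pow_mul_le_cnt_restart_mul ha hk hkN hS
  have hrun : cnt m {r | run φ d S r = false} ≤ (2 * f) ^ R * 2 ^ (m - R * (c + 1)) := by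
    rw [hf, hc']; exact cnt_run_false_le (by rw [← hc']; exact hm)
  have hsf : s + f = 2 ^ c := by
    rw [hs, hf, ← cnt_add_cnt_compl c {w | (restart φ d S w).1 = true}]
    congr 1
    exact cnt_congr fun y _ => by simp
  -- to the reals
  have hDposN : 0 < Dfull := by
    rw [hDfull]
    refine Nat.mul_pos (Nat.mul_pos (Nat.mul_pos (Nat.succ_pos _) (Nat.succ_pos _)) (Nat.pow_pos (by omega)))
      (Nat.pow_pos (by omega))
  have hDpos : (0 : ℝ) < Dfull := by exact_mod_cast hDposN
  have h2c : (0 : ℝ) < 2 ^ c := by positivity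
  set σ₀ : ℝ := (k : ℝ) ^ n / Dfull with hσ₀
  have hσ₀0 : 0 ≤ σ₀ := by rw [hσ₀]; positivity
  have hsσ : σ₀ ≤ (s : ℝ) / 2 ^ c := by
    rw [hσ₀, div_le_div_iff₀ hDpos h2c]
    have : ((2 ^ c * k ^ n : ℕ) : ℝ) ≤ ((s * Dfull : ℕ) : ℝ) := by exact_mod_cast hrest
    push_cast at this
    linarith
  have hs1 : (s : ℝ) / 2 ^ c ≤ 1 := by
    rw [div_le_one h2c]
    have : ((s : ℕ) : ℝ) ≤ ((2 ^ c : ℕ) : ℝ) := by exact_mod_cast (hsf ▸ Nat.le_add_right s f)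
    push_cast at this
    exact this
  have hσ₁ : σ₀ ≤ 1 := hsσ.trans hs1
  have hRσ : (2 : ℝ) ≤ R * σ₀ := by
    rw [hσ₀, ← mul_div_assoc, le_div_iff₀ hDpos]
    have : ((2 * Dfull : ℕ) : ℝ) ≤ ((R * k ^ n : ℕ) : ℝ) := by exact_mod_cast hR
    push_cast at this
    linarith
  have hthird := one_sub_pow_le_third hσ₀0 hσ₁ hRσ
  -- the failure probability
  have hfx : (f : ℝ) / 2 ^ c ≤ 1 - σ₀ := by
    have : (f : ℝ) = 2 ^ c - s := by
      have : ((s + f : ℕ) : ℝ) = ((2 ^ c : ℕ) : ℝ) := by rw [hsf]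
      push_cast at this; linarith
    rw [this, sub_div, div_self h2c.ne']
    linarith
  have hfail : uniformProb m {r | run φ d S r = false} ≤ 1 / 3 := by
    rw [uniformProb_eq_cnt_div, div_le_iff₀ (by positivity)]
    have hcast : (cnt m {r | run φ d S r = false} : ℝ) ≤ (2 * f) ^ R * 2 ^ (m - R * (c + 1)) := by
      exact_mod_cast hrun
    refine hcast.trans ?_
    obtain ⟨t, rfl⟩ : ∃ t, m = R * (c + 1) + t := ⟨m - R * (c + 1), by omega⟩
    rw [Nat.add_sub_cancel_left, pow_add, pow_mul, pow_succ]
    have hx : ((2 : ℝ) * f) ^ R ≤ (1 / 3) * (2 ^ c * 2) ^ R := by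
      have hle : (2 : ℝ) * f ≤ (1 - σ₀) * (2 ^ c * 2) := by
        rw [div_le_iff₀ h2c] at hfx; linarith
      calc ((2 : ℝ) * f) ^ R ≤ ((1 - σ₀) * (2 ^ c * 2)) ^ R :=
            pow_le_pow_left₀ (by positivity) hle R
        _ = (1 - σ₀) ^ R * (2 ^ c * 2) ^ R := mul_pow _ _ _
        _ ≤ _ := mul_le_mul_of_nonneg_right hthird (by positivity)
    calc ((2 : ℝ) * f) ^ R * 2 ^ t ≤ (1 / 3) * (2 ^ c * 2) ^ R * 2 ^ t :=
          mul_le_mul_of_nonneg_right hx (by positivity)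
      _ = _ := by ring
  have hcompl : {r : List Bool | run φ d S r = true} = {r | run φ d S r = false}ᶜ := by
    ext r; simp
  rw [hcompl, uniformProb_compl]
  linarith

end Literature.Computability.FineGrained.SchoeningCoin
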